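import Mathlib
import HarnessLib

/-!
# Format C (Fourier–Galerkin / Feshbach–Schur certificates of Weil positivity): the algebraic back end

Route vocabulary: `Summits/RiemannHypothesis/RiemannHypothesis/Theses/WeilParity.lean` (crux `NoParityCrossing`,
stmt-RiemannHypothesis-18085, whose sector-wise certified margins these certificates feed) and the window ladder
`Literature.NumberTheory.LFunctions.WeilPositivityOn`. Cell memo: `run/shared/lean/pub/rh-explicit/WEIL3-STRUCTURE.md`
§7 (lemma shapes L-C1…L-C4) and §9; inequality chain H1–H6 of `rh-explicit-weil-2/Y9-SOUNDNESS.md` (Yoshida 1992 §§4–7,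
*On Hermitian forms attached to zeta functions*, Adv. Stud. Pure Math. 21, at modern precision).

A format-C certificate for a window `a` and a parity sector decomposes a test vector as `φ = Σ_{i ∈ W} x_i χ_i + u`
(`W` a FINITE block of Fourier modes of `[−a, a]`, `u` in the closed span of the higher modes, `‖φ‖² = ‖x‖² + ‖u‖²`) and
writes the Weil form as `⟨φ, φ⟩ = xᵀ G x + 2·B + D` with `G` the block Gram, `B = Re Σ_i x̄_i ⟨χ_i, u⟩` the coupling and
`D = ⟨u, u⟩`.  Its ANALYTIC inputs are (H3) complement coercivity `μ_N ‖u‖² ≤ D`, (H5) a coupling majorant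
`B² ≤ (xᵀ M x)·‖u‖²` (`M ⪰ B Bᵀ + tail`), and (H1) enclosures of `G`, `M`; its KERNEL step (H6) decides
`S := G − μ⋆·1 − (μ_N − μ⋆)⁻¹·M ⪰ 0` exactly (tree: `Literature.Analysis.ValidatedNumerics.SymmetricEigenCert.checkLower`,
`PSDCert.ldltCheck`, `IntervalGershgorin.psdCheck`).  THIS FILE is the glue (H4) turning those four facts into the
conclusion `μ⋆ ‖φ‖² ≤ ⟨φ, φ⟩`, stated over `ℝ` with the analytic quantities as real parameters so that it is independent
of how the function spaces are set up:

* `two_mul_abs_le_div_add_mul` — the Peter–Paul step `2|B| ≤ m/δ + δ·n` from `B² ≤ m·n`;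
* `schurStep_scalar` — `μ⋆ (a₂ + n) ≤ A + 2B + D` from `μ⋆ a₂ + m/(μ_N − μ⋆) ≤ A`, `B² ≤ m n`, `μ_N n ≤ D`, `μ⋆ < μ_N`;
* `schurStep_form` — the same with `A = xᵀGx`, `a₂ = xᵀx`, `m = xᵀMx` and the hypothesis as the nonnegativity of the
  quadratic form of `G − μ⋆·1 − (μ_N − μ⋆)⁻¹·M`; `schurStep_posSemidef` — with that hypothesis as `Matrix.PosSemidef`;
* `sq_add_le_peterPaul`, `dotProduct_add_sq_le` — the splitting `(p + q)² ≤ (1+η)p² + (1+η⁻¹)q²` used to separate the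
  computed columns of the coupling from the modelled tail (H5 (iii)–(v)).

Elementary real algebra; no facts, no axioms beyond the standard three.  What is NOT here: the analytic inputs H1, H3, H5
(entries, Fourier-tail coercivity with explicit `μ_N`, tail model) and the dictionary to `WeilPositivityOn` (L-C4).
-/

set_option linter.dupNamespace false

namespace Summit.RiemannHypothesis.RiemannHypothesis.Theorems.WeilFormatC

open Matrix

/-! ### Scalar inequalities -/

/-- Peter–Paul with a product constraint: if `B² ≤ m·n` with `m, n ≥ 0` and `δ > 0` then `2|B| ≤ m/δ + δ·n`
(AM–GM on `m/δ` and `δ n`, whose product is `m n ≥ B²`). -/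
theorem two_mul_abs_le_div_add_mul {B m n δ : ℝ} (hδ : 0 < δ) (hm : 0 ≤ m) (hn : 0 ≤ n)
    (hB : B ^ 2 ≤ m * n) : 2 * |B| ≤ m / δ + δ * n := by
  have h1 : 0 ≤ m / δ := div_nonneg hm hδ.le
  have h2 : 0 ≤ δ * n := mul_nonneg hδ.le hn
  have hprod : m / δ * (δ * n) = m * n := by
    field_simp
  have key : (2 * |B|) ^ 2 ≤ (m / δ + δ * n) ^ 2 := by
    have e : (m / δ + δ * n) ^ 2 = (m / δ - δ * n) ^ 2 + 4 * (m * n) := by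
      rw [← hprod]; ring
    rw [e]
    nlinarith [sq_abs B, sq_nonneg (m / δ - δ * n)]
  exact (pow_le_pow_iff_left₀ (by positivity) (add_nonneg h1 h2) two_ne_zero).mp key

/-- **The Schur step, scalar form** (H4 of the format-C chain).  With `A = xᵀGx`, `a₂ = ‖x‖²`, `2B` the coupling,
`D = ⟨u,u⟩`, `n = ‖u‖²`, `m = xᵀMx`: from `μ⋆ a₂ + m/(μ_N − μ⋆) ≤ A` (the certified matrix inequality),
`B² ≤ m n` (coupling majorant), `μ_N n ≤ D` (complement coercivity) and `μ⋆ < μ_N` one gets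
`μ⋆ (a₂ + n) ≤ A + 2B + D` — i.e. `μ⋆ ‖φ‖² ≤ ⟨φ, φ⟩`.  Minimising over the tail is replaced by Peter–Paul. -/
theorem schurStep_scalar {A B D a₂ n m μN μs : ℝ} (hμ : μs < μN) (hn : 0 ≤ n) (hm : 0 ≤ m)
    (hB : B ^ 2 ≤ m * n) (hD : μN * n ≤ D) (hS : μs * a₂ + m / (μN - μs) ≤ A) :
    μs * (a₂ + n) ≤ A + 2 * B + D := by
  have hδ : 0 < μN - μs := sub_pos.mpr hμ
  have hpp := two_mul_abs_le_div_add_mul hδ hm hn hB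
  have hB' : -(2 * B) ≤ 2 * |B| := by
    have := neg_abs_le B
    linarith
  nlinarith [hpp, hB', hD, hS]

/-! ### Quadratic-form packaging -/

section Form

variable {ι : Type*} [Fintype ι] [DecidableEq ι]

/-- The quadratic form of `G − μ⋆·1 − c·M` at `y`, expanded. -/
theorem dotProduct_sub_smul_one_sub_smul_mulVec (G M : Matrix ι ι ℝ) (μs c : ℝ) (y : ι → ℝ) :
    y ⬝ᵥ (G - μs • (1 : Matrix ι ι ℝ) - c • M) *ᵥ y
      = y ⬝ᵥ G *ᵥ y - μs * (y ⬝ᵥ y) - c * (y ⬝ᵥ M *ᵥ y) := by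
  rw [sub_mulVec, sub_mulVec, dotProduct_sub, dotProduct_sub, smul_mulVec, smul_mulVec, one_mulVec,
    dotProduct_smul, dotProduct_smul, smul_eq_mul, smul_eq_mul]

/-- **The Schur step, quadratic-form version.**  `G` = block Gram of the sector Weil form on the finite mode set `ι`,
`M ⪰ 0` a majorant of the coupling Gram (`B² ≤ (xᵀMx)·‖u‖²`), `μ_N` the complement coercivity constant, `μ⋆ < μ_N` the
claimed margin.  If the quadratic form of `S = G − μ⋆·1 − (μ_N − μ⋆)⁻¹·M` is nonnegative (the kernel-decided step), then
for every coefficient vector `x` and every tail with squared norm `n`, self-energy `D ≥ μ_N n` and coupling `B`: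
`μ⋆ (xᵀx + n) ≤ xᵀGx + 2B + D`. -/
theorem schurStep_form (G M : Matrix ι ι ℝ) (x : ι → ℝ) {B D n μN μs : ℝ} (hμ : μs < μN) (hn : 0 ≤ n)
    (hM : 0 ≤ x ⬝ᵥ M *ᵥ x) (hB : B ^ 2 ≤ (x ⬝ᵥ M *ᵥ x) * n) (hD : μN * n ≤ D)
    (hS : ∀ y : ι → ℝ, 0 ≤ y ⬝ᵥ (G - μs • (1 : Matrix ι ι ℝ) - (μN - μs)⁻¹ • M) *ᵥ y) :
    μs * (x ⬝ᵥ x + n) ≤ x ⬝ᵥ G *ᵥ x + 2 * B + D := by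
  have h := hS x
  rw [dotProduct_sub_smul_one_sub_smul_mulVec] at h
  refine schurStep_scalar hμ hn hM hB hD ?_
  rw [div_eq_mul_inv, mul_comm (x ⬝ᵥ M *ᵥ x)]
  linarith

/-- **The Schur step from a `PosSemidef` certificate.**  Same as `schurStep_form` with the kernel step delivered as
`(G − μ⋆·1 − (μ_N − μ⋆)⁻¹·M).PosSemidef` — the shape produced by `Literature.Analysis.ValidatedNumerics.PSDCert` /
`IntervalGershgorin.posSemidef_of_psdCheck` on the rounded-minus-radius rational matrix. -/
theorem schurStep_posSemidef (G M : Matrix ι ι ℝ) (x : ι → ℝ) {B D n μN μs : ℝ} (hμ : μs < μN) (hn : 0 ≤ n)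
    (hM : 0 ≤ x ⬝ᵥ M *ᵥ x) (hB : B ^ 2 ≤ (x ⬝ᵥ M *ᵥ x) * n) (hD : μN * n ≤ D)
    (hS : (G - μs • (1 : Matrix ι ι ℝ) - (μN - μs)⁻¹ • M).PosSemidef) :
    μs * (x ⬝ᵥ x + n) ≤ x ⬝ᵥ G *ᵥ x + 2 * B + D :=
  schurStep_form G M x hμ hn hM hB hD fun y => by simpa using hS.dotProduct_mulVec_nonneg y

/-- A majorant of the coupling Gram gives the product bound the Schur step consumes: if `B = Σ_k β_k γ_k`
(a finite piece of the coupling, `β_k = (Bᵀx)_k`, `γ_k` the tail coefficients) then `B² ≤ (Σ β_k²)(Σ γ_k²)`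
(Cauchy–Schwarz, `Finset` form; the infinite version is obtained termwise in the limit by the user). -/
theorem sq_sum_mul_le_sum_sq_mul_sum_sq {κ : Type*} (s : Finset κ) (β γ : κ → ℝ) :
    (∑ k ∈ s, β k * γ k) ^ 2 ≤ (∑ k ∈ s, β k ^ 2) * (∑ k ∈ s, γ k ^ 2) :=
  Finset.sum_mul_sq_le_sq_mul_sq s β γ

end Form

/-! ### Splitting inequalities for the coupling tail (H5 (iii)–(v)) -/

/-- Peter–Paul splitting of a square: `(p + q)² ≤ (1 + η) p² + (1 + η⁻¹) q²` for `η > 0`. -/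
theorem sq_add_le_peterPaul {p q η : ℝ} (hη : 0 < η) :
    (p + q) ^ 2 ≤ (1 + η) * p ^ 2 + (1 + η⁻¹) * q ^ 2 := by
  have hη' : 0 < η⁻¹ := inv_pos.mpr hη
  have key : 2 * p * q ≤ η * p ^ 2 + η⁻¹ * q ^ 2 := by
    have h1 : 0 ≤ (η * p - q) ^ 2 := sq_nonneg _
    have h2 : η⁻¹ * (η * p - q) ^ 2 = η * p ^ 2 - 2 * p * q + η⁻¹ * q ^ 2 := by
      field_simp
      ring
    nlinarith [mul_nonneg hη'.le h1]
  nlinarith [key]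

/-- The same splitting for rank-one forms: for vectors `u v` and any `x`,
`(x ⬝ᵥ (u + v))² ≤ (1 + η)(x ⬝ᵥ u)² + (1 + η⁻¹)(x ⬝ᵥ v)²`, i.e. `(u+v)(u+v)ᵀ ⪯ (1+η) uuᵀ + (1+η⁻¹) vvᵀ`
as quadratic forms (used with `u` = structured part of a coupling column, `v` = its remainder). -/
theorem dotProduct_add_sq_le {ι : Type*} [Fintype ι] (x u v : ι → ℝ) {η : ℝ} (hη : 0 < η) :
    (x ⬝ᵥ (u + v)) ^ 2 ≤ (1 + η) * (x ⬝ᵥ u) ^ 2 + (1 + η⁻¹) * (x ⬝ᵥ v) ^ 2 := by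
  rw [dotProduct_add]
  exact sq_add_le_peterPaul hη

/-- Cauchy–Schwarz for `dotProduct`: `(x ⬝ᵥ e)² ≤ (x ⬝ᵥ x)(e ⬝ᵥ e)` — the remainder columns `e_m` of the coupling
enter the majorant `M` through `Σ_m (x ⬝ᵥ e_m)² ≤ (x ⬝ᵥ x) · Σ_m ‖e_m‖²`, i.e. as `ε_e · 1`. -/
theorem dotProduct_sq_le_dotProduct_self_mul {ι : Type*} [Fintype ι] (x e : ι → ℝ) :
    (x ⬝ᵥ e) ^ 2 ≤ (x ⬝ᵥ x) * (e ⬝ᵥ e) := by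
  have h := sq_sum_mul_le_sum_sq_mul_sum_sq Finset.univ x e
  simpa [dotProduct, pow_two] using h

end Summit.RiemannHypothesis.RiemannHypothesis.Theorems.WeilFormatC
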